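import Mathlib

/-!
# Weil-tangent summand law — the one abstract Lie step, kernel-checked (plan-lens-HodgeAV-embed g15)

token: `line stmt-HodgeConjecture-18881 Cruxes/BlochSeedDiscOne/Lines/birth.lean 814a6a70c14e831a stub_rung_pad4_seedAt`
(UNTOUCHED; nothing here is evidence toward HC ∕ HC_CM ∕ HC_AV ∕ №4 ∕ 26512 ∕ 18881 ∕ H2; census-neutral; Mathlib only;
no `sorry`, no `instance`, no `notation`, no `axiom`, no `native_decide`, no banned option).

The memo `WEIL-TANGENT-SUMMAND-LAW-embed-g15.md` §2 step (4) uses: if a cohomology class `z` is annihilated by every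
Kodaira–Spencer direction of the Weil family, `𝔭 · z = 0` (`𝔭 ⊂ 𝔰𝔲(n,n)` the tangent space of
`SU(n,n)/S(U(n)×U(n))`), then `𝔰𝔲(n,n) · z = 0`, because `𝔭` Lie-generates `𝔰𝔲(n,n)` (`[𝔭,𝔭] = 𝔨` for a simple
non-compact `𝔤 = 𝔨 ⊕ 𝔭`). The abstract content is the lemma below: the annihilator of a vector under a Lie action is a
Lie subalgebra, so a Lie-generating set of annihilating elements makes the whole algebra annihilate. [folklore]
-/

namespace HSemireg.WeilTangentSummandLaw

variable {R L M : Type*} [CommRing R] [LieRing L] [LieAlgebra R L]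
  [AddCommGroup M] [Module R M] [LieRingModule L M] [LieModule R L M]

/-- The annihilator `{x ∈ L | ⁅x, m⁆ = 0}` of a vector `m` of a Lie module, as a Lie subalgebra. [folklore] -/
def annihilatorSubalgebra (m : M) : LieSubalgebra R L where
  carrier := {x | ⁅x, m⁆ = 0}
  add_mem' := by
    intro a b ha hb
    simp only [Set.mem_setOf_eq] at ha hb ⊢
    rw [add_lie, ha, hb, add_zero]
  zero_mem' := by simp
  smul_mem' := by
    intro c x hx
    simp only [Set.mem_setOf_eq] at hx ⊢
    rw [smul_lie, hx, smul_zero]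
  lie_mem' := by
    intro x y hx hy
    simp only [Set.mem_setOf_eq] at hx hy ⊢
    rw [lie_lie, hx, hy, lie_zero, lie_zero, sub_zero]

@[simp] theorem mem_annihilatorSubalgebra {m : M} {x : L} :
    x ∈ annihilatorSubalgebra (R := R) m ↔ ⁅x, m⁆ = 0 := Iff.rfl

/-- **Generators suffice.** If `S ⊆ L` Lie-generates `L` and every `s ∈ S` annihilates `m`, then all of `L`
annihilates `m`. Used with `L = 𝔰𝔲(n,n)`, `S = 𝔭` (the Weil-family tangent directions), `M = H^{2p}(X, ℂ)`,
`m = ch_p` of a direct summand. [folklore] -/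
theorem lie_eq_zero_of_lieSpan_eq_top {S : Set L} (hS : LieSubalgebra.lieSpan R L S = ⊤) {m : M}
    (h : ∀ s ∈ S, ⁅s, m⁆ = 0) (x : L) : ⁅x, m⁆ = 0 := by
  have hle : LieSubalgebra.lieSpan R L S ≤ annihilatorSubalgebra (R := R) m :=
    LieSubalgebra.lieSpan_le.mpr fun s hs => h s hs
  have hx : x ∈ LieSubalgebra.lieSpan R L S := by rw [hS]; trivial
  exact hle hx

/-- The same with a SPANNING hypothesis one bracket deep (the form `𝔨 = [𝔭,𝔭]`, `𝔤 = 𝔨 ⊕ 𝔭` is used in): if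
`S ∪ {⁅s,t⁆ | s t ∈ S}` spans `L` as an `R`-module, then `S` Lie-generates `L`, hence annihilation by `S` is
annihilation by `L`. [folklore] -/
theorem lie_eq_zero_of_span_brackets_eq_top {S : Set L}
    (hS : Submodule.span R (S ∪ {z | ∃ s ∈ S, ∃ t ∈ S, ⁅s, t⁆ = z}) = ⊤) {m : M}
    (h : ∀ s ∈ S, ⁅s, m⁆ = 0) (x : L) : ⁅x, m⁆ = 0 := by
  -- the span of `S ∪ [S,S]` lies inside the annihilator submodule
  have hsub : ∀ z ∈ S ∪ {z | ∃ s ∈ S, ∃ t ∈ S, ⁅s, t⁆ = z},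
      z ∈ (annihilatorSubalgebra (R := R) (L := L) m).toSubmodule := by
    rintro z (hz | ⟨s, hs, t, ht, rfl⟩)
    · exact h z hz
    · change ⁅⁅s, t⁆, m⁆ = 0
      rw [lie_lie, h s hs, h t ht, lie_zero, lie_zero, sub_zero]
  have hle : Submodule.span R (S ∪ {z | ∃ s ∈ S, ∃ t ∈ S, ⁅s, t⁆ = z}) ≤
      (annihilatorSubalgebra (R := R) (L := L) m).toSubmodule := Submodule.span_le.mpr hsub
  have hx : x ∈ (annihilatorSubalgebra (R := R) (L := L) m).toSubmodule := hle (by rw [hS]; trivial)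
  exact hx

end HSemireg.WeilTangentSummandLaw
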